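/-
Copyright: statement-level skeleton of a published paper (lit-balaban cell, Phase-2 proof seat p39 gen 6). No proof claims
beyond what the kernel checks below.
-/
import Literature.MathematicalPhysics.QuantumFieldTheory.Balaban1983to89.B3Eq316ResolventZeroTorus
import Literature.MathematicalPhysics.QuantumFieldTheory.Balaban1983to89.B3KernelConvolutionTorus
import Literature.MathematicalPhysics.QuantumFieldTheory.Balaban1983to89.B3Bound316Cxi
import Literature.MathematicalPhysics.QuantumFieldTheory.Balaban1983to89.B3Eq324Torus

/-!
# B3 — T. Bałaban, *(Higgs)₂,₃ quantum fields in a finite volume. III. Renormalization*, CMP **88** (1983) 411–445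
[Balaban1983Higgs3], p. 437 [PDF 27]: **"Using the inequalities |C^ξ(y − y′)| ≦ O(1)e^{−½|y−y′|}/|y − y′|,
|G^ξ_{j″}(0; y, y′)| ≦ O(1)e^{−δ₀|y−y′|}/|y − y′|, and the corresponding inequalities for derivatives, we can estimate (3.16) by a
constant"** — PROVED WITH EVERY KERNEL HYPOTHESIS DISCHARGED for the zero-field torus MODEL INSTANCE: `G^ξ_{j″}(0) = G^ξ_{j″}` = the
rescaled torus propagator `G0xi` of Bałaban's scalar tower (`A = B̃ = 0`, `Ω = T_η`), `C^ξ` = the torus free propagator `CxiT ξ`,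
`M = G^ξ_{j″}(0) − C^ξ_T` (`Mxi`); `d = 3`, one constant for all volumes, all scales `1 ≤ k = j″ ≤ K` (`ξ = L^{−k}`), all
localizations `|g|, |g′| ≤ 1`, the printed displacement `(y′_μ − y_μ)`

statement-level skeleton of published theorems with citation tags; proofs where landed; nothing here is a claim about
the Yang–Mills mass gap

PDF held: `paper:balaban1983-higgs-2-3-quantum-fields-finite-volume` (journal page = PDF page + 410); p. 437 [PDF 27] read in
the OCR text (`p0027.txt`).  Row **B3.Eq3.11-3.17** of `HOME/lit-balaban-r15/ROWS-B3.md` (fold owner r15), sub-display (3.16) and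
the sentence after it.  THIS FILE (file 4/4 of this seat's gen 6) CLOSES the kernel hypotheses of p20 g2's `B3Bound316.abs_bracket316_le`
at the model instance: `hC` (p03 g3's `B3CxiTorusBound.CxiT_hC`, as in p20 g4's `B3Bound316Cxi`), `hG` (this seat's
`B3GkZeroTorusRescaled.G0xi_bounds`), and the LAST one, **`hM`** — *"the corresponding inequalities for derivatives"* for the
derivative kernel `(∂^ξ_νM∂^{ξ*}_ν)(y,y′)` of `M = G^ξ_{j″}(0)(1 − m²_{j″} − a_{j″}P_{j″})C^ξ` — from the resolvent identity
(`B3Eq316ResolventZeroTorus.dKernel_Mxi_split`), the factor bounds at all sites (`G0xi_bounds`; this seat's gen 4/5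
`B3CxiTorusDerivativeBound.abs_d1Kernel_CxiT_le'`, `B3Eq324Torus.abs_d1Kernel_CxiT_diag_le`) and the lattice convolution estimate
(`B3KernelConvolutionTorus.conv_le_offdiag` / `conv_block_le`).
* §1 `abs_d1Kernel_CxiT_profile` — the C-factor at ALL sites: `|(∂^ξ_νC^ξ_T)(y,z)| ≤ B_C(ξ·max(1,|y−z|))^{−2}e^{−½ξ|y−z|}`,
  `B_C = 3037500 + torusConst + 472501`.
* §2 **`hM_zero_torus`** — THE DERIVATIVE-KERNEL BOUND: `∃ δ′ B′ > 0` (functions of `L, a, m²`) with, for every volume `P = (3,L,m,K)`,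
  every `1 ≤ k ≤ K`, all `ν` and `y′ ≠ y`: `|(∂^ξ_νM∂^{ξ*}_ν)(y,y′)| ≤ B′(ξ|y−y′|)^{−2}e^{−δ′ξ|y−y′|}` — exactly the hypothesis `hM`.
* §3 **`bracket316_zero_torus`** — p. 437 VERBATIM CONCLUSION for the instance: `∃ Cst` with `|[(3.16)](y)| ≤ Cst` for every volume,
  scale, `μ`, `y`, `|g|,|g′| ≤ 1` and the printed displacement (`B3Bound316.abs_bracket316_le_disp` with `hC`, `hG`, `hM` discharged,
  the three rates merged into their minimum, `radialConst` taken at `ξ = 1`); **`bracket315_zero_torus`** — the same for the (3.15)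
  bracket *"the coefficient in the vertex"* with `G^ξ_{j″}(0) = G^ξ_{j″} = G0xi` (p20's `B3Bound316Cxi.eq316_bracket_CxiT`: the split
  `G^ξ_{j″}(0) = C^ξ_T + M` holds by the definition of `M`); `expr315_zero_torus` — hence the whole expression (3.15) (r15's `expr315`)
  is a vertex with a BOUNDED coefficient: `|(3.15)| ≤ Cst·Σ_μΣ_y ξ³‖φ(y)‖‖q²(∂^ξ_μφ′)(y)‖` (the content of (3.17) *"of the required form (3.5)"*).
HONEST SCOPE: `d = 3` (the dimension in which p. 437 writes `1/|y − y′|`); `A = B̃ = 0`, `U ≡ 1`, `Ω` = the whole torus (scope of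
`B4Thm110ZeroTorus`); both propagators of (3.15) are the SAME zero-field `G_k(T_ε,0)` rescaled (at zero field `G_{j″}(0) = G_{j″}`);
fixed `a > 0`, `m² ≥ 0`; constants existential; the sup torus distance.  NOT claimed: `Ω ⊊ T_η`, `B̃ ≠ 0` (rows B3.Eq2.10–2.12 at the
print's generality), `d = 2`, numerical values.  Mathlib + the cited tree files only; theorems only, no new definitions, no named
facts; standard axioms.  Unit `lit-balaban-p39-g6` (Phase-2 proof seat p39, gen 6), HOME `run/shared/lean/pub/lit-balaban/`, 2026-08-21.
-/

open scoped BigOperators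

namespace Literature.MathematicalPhysics.QuantumFieldTheory.Balaban1983to89.B3Bound316ZeroTorus

open Matrix Finset B1RG242Torus B3GkZeroTorusRescaled B3Eq316ResolventZeroTorus B3KernelConvolutionTorus
open LatticeFieldCalculus B3Sect3ScalarSelfEnergy B3TorusRadialSums B3Bound316 B3Bound316Cxi B3CxiTorusBound
open B3CxiTorusDerivativeBound B3Eq324Torus B3Taylor310Remainder

noncomputable section

variable {P : Params}

/-! ## §1 The C-factor at all sites -/

/-- **The derivative kernel of the torus free propagator at ALL sites** (`d = 3`, `0 < ξ ≤ 1`, `ξN ≥ 1`):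
`|(∂^ξ_νC^ξ_T)(y,z)| ≤ (3037500 + torusConst + 472501)·(ξ·max(1,|y−z|_∞))^{−2}e^{−½ξ|y−z|_∞}` — off the diagonal this seat's
`abs_d1Kernel_CxiT_le'`, on it `abs_d1Kernel_CxiT_diag_le`. [cite: Balaban1983Higgs3, (3.16) p.437] -/
theorem abs_d1Kernel_CxiT_profile {j : ℕ} (hd : P.d = 3) {ξ : ℝ} (hξ : 0 < ξ) (hξ1 : ξ ≤ 1)
    (hN : 1 ≤ ξ * (P.sitesPerDir j : ℝ)) (ν : Fin P.d) (y z : Site P j) :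
    |d1Kernel ξ⁻¹ ν (CxiT ξ) y z| ≤ (3037500 + torusConst + 472501) *
      (((ξ * max (1 : ℝ) (supDist y z : ℝ)) ^ 2)⁻¹ * Real.exp (-(1 / 2 * (ξ * (supDist y z : ℝ))))) := by
  have hT := torusConst_nonneg
  by_cases hne : z = y
  · subst hne
    have h := abs_d1Kernel_CxiT_diag_le hd hξ hξ1 hN ν z
    rw [max_one_supDist_self, (supDist_eq_zero_iff z z).mpr rfl, Nat.cast_zero, mul_zero, mul_zero, neg_zero,
      Real.exp_zero, mul_one, mul_one]
    refine h.trans ?_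
    have h0 : 0 ≤ (ξ ^ 2)⁻¹ := by positivity
    nlinarith
  · have h := abs_d1Kernel_CxiT_le' hd hξ hξ1 hN hne ν
    rw [max_one_supDist_of_ne hne]
    refine h.trans ?_
    have h0 : 0 ≤ ((ξ * (supDist y z : ℝ)) ^ 2)⁻¹ * Real.exp (-(1 / 2 * (ξ * (supDist y z : ℝ)))) := by positivity
    rw [mul_assoc]
    nlinarith

/-! ## §2 `hM`: the derivative kernel of `M = G^ξ_k(0) − C^ξ_T` -/

/-- kernel: weakening an exponential rate, `e^{−ct} ≤ e^{−c′t}` for `c′ ≤ c`, `t ≥ 0`. [folklore] -/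
private theorem exp_rate_mono {c c' t : ℝ} (h : c' ≤ c) (ht : 0 ≤ t) : Real.exp (-(c * t)) ≤ Real.exp (-(c' * t)) :=
  Real.exp_le_exp.mpr (by nlinarith)

/-- **`hM` DISCHARGED AT THE ZERO-FIELD TORUS INSTANCE** — p. 437 *"the corresponding inequalities for derivatives"* for
`M = G^ξ_{j″}(0)(1 − m²_{j″} − a_{j″}P_{j″})C^ξ`: for odd `L > 1`, `a > 0`, `m² ≥ 0` there are `δ′, B′ > 0` (functions of `L, a, m²`)
such that for EVERY volume `P = (3, L, m, K)`, every `1 ≤ k ≤ K` (`ξ = L^{−k}`), all `ν` and `y′ ≠ y`: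
`|(∂^ξ_νM∂^{ξ*}_ν)(y,y′)| ≤ B′·(ξ|y−y′|)^{−2}·e^{−δ′ξ|y−y′|}` — the hypothesis `hM` of `B3Bound316.abs_bracket316_le` for
`M = Mxi P a msq k`.  Route: `dKernel_Mxi_split` + `G0xi_bounds` + `abs_d1Kernel_CxiT_profile` + `conv_le_offdiag`/`conv_block_le`
(`P_k`: `Pk_abs_le`, `eta_supDist_le_two_of_Pk_ne_zero`). [cite: Balaban1983Higgs3, (3.16) p.437] -/
theorem hM_zero_torus (L : ℕ) (hL : Odd L ∧ 1 < L) {a : ℝ} (ha : 0 < a) {msq : ℝ} (hmsq : 0 ≤ msq) :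
    ∃ δ' B' : ℝ, 0 < δ' ∧ 0 < B' ∧ ∀ (P : Params), P.d = 3 → P.L = L → ∀ k : ℕ, 1 ≤ k → k ≤ P.K →
      ∀ (ν : Fin P.d) (y y' : Site P 0), y' ≠ y →
        |dKernel (P.eta k)⁻¹ ν (Mxi P a msq k) y y'| ≤
          B' * ((P.eta k * (supDist y y' : ℝ)) ^ 2)⁻¹ * Real.exp (-(δ' * (P.eta k * (supDist y y' : ℝ)))) := by
  obtain ⟨δ, C, hδ, hC, HG⟩ := G0xi_bounds L hL ha hmsq
  -- the C-side constant and the merged rate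
  set b : ℝ := 3037500 + torusConst + 472501 with hb
  have hb0 : 0 ≤ b := by have := torusConst_nonneg; rw [hb]; linarith
  set γ : ℝ := min δ (1 / 2) / 2 with hγ
  have hγ0 : 0 < γ := by rw [hγ]; exact div_pos (lt_min hδ one_half_pos) two_pos
  have hγδ : 2 * γ ≤ δ := by rw [hγ]; linarith [min_le_left δ (1 / 2)]
  have hγh : 2 * γ ≤ 1 / 2 := by rw [hγ]; linarith [min_le_right δ (1 / 2)]
  -- the radial constants at ξ = 1
  set R₁ : ℝ := radialConst 3 δ 1 0 with hR₁
  set R₂ : ℝ := radialConst 3 (1 / 2) 1 0 with hR₂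
  set R₃ : ℝ := radialConst 3 (δ / 2) 1 0 with hR₃
  set R₄ : ℝ := radialConst 3 (1 / 2 / 2) 1 0 with hR₄
  have hR₁0 : 0 ≤ R₁ := radialConst_nonneg 3 hδ zero_le_one 0
  have hR₂0 : 0 ≤ R₂ := radialConst_nonneg 3 one_half_pos zero_le_one 0
  have hR₃0 : 0 ≤ R₃ := radialConst_nonneg 3 (half_pos hδ) zero_le_one 0
  have hR₄0 : 0 ≤ R₄ := radialConst_nonneg 3 (half_pos one_half_pos) zero_le_one 0
  set B₁ : ℝ := 4 * C * b * (2 + R₁ + R₂) with hB₁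
  set B₂ : ℝ := 8 * 1 * C * b * Real.exp (2 * γ) * (1 + R₃) * (1 + R₄) * (γ ^ 2)⁻¹ with hB₂
  have hB₁0 : 0 ≤ B₁ := by rw [hB₁]; positivity
  have hB₂0 : 0 ≤ B₂ := by rw [hB₂]; positivity
  refine ⟨γ / 2, (1 + msq) * B₁ + a * B₂ + 1, half_pos hγ0, by positivity, fun P hPd hPL k hk1 hkK ν y y' hne => ?_⟩
  obtain ⟨-, hGd⟩ := HG P hPd hPL k hk1 hkK
  have hkm : k ≤ P.m + P.K := hkK.trans (Nat.le_add_left _ _)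
  have hη : 0 < P.eta k := eta_pos P k
  have hη1 : P.eta k ≤ 1 := eta_le_one P k
  have hN : 1 ≤ P.eta k * (P.sitesPerDir 0 : ℝ) := one_le_eta_mul_sitesPerDir P hkm
  have hs1 : P.spacing k ≤ 1 := spacing_le_one P hkK
  have hs0 : 0 < P.spacing k := P.spacing_pos k
  have hL1 : (1 : ℝ) < (P.L : ℝ) := one_lt_cast_L P
  -- the two factor profiles at all sites
  have hA : ∀ w z : Site P 0, |d1Kernel (P.eta k)⁻¹ ν (G0xi P a msq k) w z| ≤
      C * (((P.eta k * max (1 : ℝ) (supDist w z : ℝ)) ^ 2)⁻¹ * Real.exp (-(δ * (P.eta k * (supDist w z : ℝ))))) :=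
    fun w z => hGd ν w z
  have hB' : ∀ z w : Site P 0, |(fun z w : Site P 0 => d1Kernel (P.eta k)⁻¹ ν (CxiT (P.eta k)) w z) z w| ≤
      b * (((P.eta k * max (1 : ℝ) (supDist z w : ℝ)) ^ 2)⁻¹ * Real.exp (-(1 / 2 * (P.eta k * (supDist z w : ℝ))))) := by
    intro z w
    have h := abs_d1Kernel_CxiT_profile hPd hη hη1 hN ν w z
    simp only [supDist_comm w z] at h
    exact h
  -- the block kernel `P_k`
  have hE : ∀ z z' : Site P 0, |(Qks P k * Qk P k) z z'| ≤ 1 * P.eta k ^ P.d := fun z z' => by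
    rw [one_mul]; exact Pk_abs_le hkm z z'
  have hEs : ∀ z z' : Site P 0, (Qks P k * Qk P k) z z' ≠ 0 → P.eta k * (supDist z z' : ℝ) ≤ 2 :=
    fun z z' h => eta_supDist_le_two_of_Pk_ne_zero hkm h
  -- the two convolution estimates
  have hI := conv_le_offdiag hPd hη hη1 hδ one_half_pos hγ0.le hγδ hγh hC.le hb0
    (fun w z => d1Kernel (P.eta k)⁻¹ ν (G0xi P a msq k) w z)
    (fun z w => d1Kernel (P.eta k)⁻¹ ν (CxiT (P.eta k)) w z) hA hB' hne
  have hII := conv_block_le hPd hη hη1 hδ one_half_pos hγ0 hγδ hγh hC.le hb0 zero_le_one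
    (fun w z => d1Kernel (P.eta k)⁻¹ ν (G0xi P a msq k) w z) (fun z z' => (Qks P k * Qk P k) z z')
    (fun z w => d1Kernel (P.eta k)⁻¹ ν (CxiT (P.eta k)) w z) hA hB' hE hEs hne
  -- the radial constants at ξ ≤ 1
  have hRm : ∀ {c : ℝ}, 0 < c → radialConst P.d c (P.eta k) 0 ≤ radialConst 3 c 1 0 := by
    intro c hc; rw [hPd]; exact radialConst_mono 3 hc hη1 0
  set n : ℝ := (supDist y y' : ℝ) with hn
  have hn1 : 1 ≤ n := one_le_supDist_of_ne hne
  set t : ℝ := P.eta k * n with ht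
  have ht0 : 0 < t := mul_pos hη (by linarith)
  set W : ℝ := ((t) ^ 2)⁻¹ * Real.exp (-(γ / 2 * t)) with hW
  have hW0 : 0 ≤ W := by positivity
  -- Term I ≤ B₁·W, Term II ≤ B₂·W
  have hI' : ∑ z : Site P 0, P.eta k ^ P.d * (|d1Kernel (P.eta k)⁻¹ ν (G0xi P a msq k) y z| *
      |d1Kernel (P.eta k)⁻¹ ν (CxiT (P.eta k)) y' z|) ≤ B₁ * W := by
    refine hI.trans ?_
    have h1 : 4 * C * b * (2 + radialConst P.d δ (P.eta k) 0 + radialConst P.d (1 / 2) (P.eta k) 0) ≤ B₁ := by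
      rw [hB₁]
      have := hRm hδ; have := hRm one_half_pos
      gcongr
    have h2 : (t ^ 2)⁻¹ * Real.exp (-(γ * t)) ≤ W := by
      rw [hW]
      exact mul_le_mul_of_nonneg_left (exp_rate_mono (by linarith) ht0.le) (by positivity)
    exact mul_le_mul h1 h2 (by positivity) hB₁0
  have hII' : ∑ z : Site P 0, ∑ z' : Site P 0, P.eta k ^ P.d * (|d1Kernel (P.eta k)⁻¹ ν (G0xi P a msq k) y z| *
      |(Qks P k * Qk P k) z z'| * |d1Kernel (P.eta k)⁻¹ ν (CxiT (P.eta k)) y' z'|) ≤ B₂ * W := by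
    refine hII.trans ?_
    have h1 : 8 * 1 * C * b * Real.exp (2 * γ) * (1 + radialConst P.d (δ / 2) (P.eta k) 0) *
        (1 + radialConst P.d (1 / 2 / 2) (P.eta k) 0) * (γ ^ 2)⁻¹ ≤ B₂ := by
      rw [hB₂]
      have := hRm (half_pos hδ); have := hRm (half_pos one_half_pos)
      have h3 : 0 ≤ 1 + radialConst P.d (δ / 2) (P.eta k) 0 := by
        have := radialConst_nonneg P.d (half_pos hδ) hη.le 0; linarith
      have h4 : 0 ≤ 1 + radialConst P.d (1 / 2 / 2) (P.eta k) 0 := by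
        have := radialConst_nonneg P.d (half_pos one_half_pos) hη.le 0; linarith
      gcongr
    exact mul_le_mul_of_nonneg_right h1 hW0
  -- assembling `|dKernel M| ≤ ((1+m²)B₁ + aB₂)·W`
  have hc₁ : |1 - P.spacing k ^ 2 * msq| ≤ 1 + msq := by
    have hs2 : P.spacing k ^ 2 ≤ 1 := pow_le_one₀ hs0.le hs1
    have hsm : P.spacing k ^ 2 * msq ≤ msq := mul_le_of_le_one_left hmsq hs2
    have hsm0 : 0 ≤ P.spacing k ^ 2 * msq := mul_nonneg (pow_nonneg hs0.le 2) hmsq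
    rw [abs_le]; constructor <;> linarith
  have hc₂ : 0 ≤ B1.aSeq a P.L k := (B1.aSeq_pos ha hL1 hk1).le
  have hc₂' : B1.aSeq a P.L k ≤ a := B1.aSeq_le ha hL1 k hk1
  rw [dKernel_Mxi_split ha hmsq hk1]
  have hηd : 0 < P.eta k ^ P.d := pow_pos hη _
  -- push `ξ^d` and absolute values inside
  have hT1 : |P.eta k ^ P.d * ((1 - P.spacing k ^ 2 * msq) *
      ∑ z : Site P 0, d1Kernel (P.eta k)⁻¹ ν (G0xi P a msq k) y z * d1Kernel (P.eta k)⁻¹ ν (CxiT (P.eta k)) y' z)| ≤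
      (1 + msq) * (B₁ * W) := by
    rw [abs_mul, abs_of_pos hηd, abs_mul, mul_left_comm]
    refine mul_le_mul hc₁ ?_ (by positivity) (by positivity)
    rw [← abs_of_pos hηd, ← abs_mul, Finset.mul_sum]
    refine (Finset.abs_sum_le_sum_abs _ _).trans (le_trans (Finset.sum_le_sum fun z _ => ?_) hI')
    rw [abs_mul, abs_mul, abs_of_pos hηd]
  have hT2 : |P.eta k ^ P.d * (B1.aSeq a P.L k * ∑ z : Site P 0, ∑ z' : Site P 0,
      d1Kernel (P.eta k)⁻¹ ν (G0xi P a msq k) y z * (Qks P k * Qk P k) z z' *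
        d1Kernel (P.eta k)⁻¹ ν (CxiT (P.eta k)) y' z')| ≤ a * (B₂ * W) := by
    rw [abs_mul, abs_of_pos hηd, abs_mul, abs_of_nonneg hc₂, mul_left_comm]
    refine mul_le_mul hc₂' ?_ (by positivity) ha.le
    rw [← abs_of_pos hηd, ← abs_mul, Finset.mul_sum]
    refine (Finset.abs_sum_le_sum_abs _ _).trans (le_trans (Finset.sum_le_sum fun z _ => ?_) hII')
    rw [Finset.mul_sum]
    refine (Finset.abs_sum_le_sum_abs _ _).trans (Finset.sum_le_sum fun z' _ => ?_)
    rw [abs_mul, abs_mul, abs_mul, abs_of_pos hηd]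
  rw [mul_sub]
  calc |P.eta k ^ P.d * ((1 - P.spacing k ^ 2 * msq) *
          ∑ z : Site P 0, d1Kernel (P.eta k)⁻¹ ν (G0xi P a msq k) y z * d1Kernel (P.eta k)⁻¹ ν (CxiT (P.eta k)) y' z) -
        P.eta k ^ P.d * (B1.aSeq a P.L k * ∑ z : Site P 0, ∑ z' : Site P 0,
          d1Kernel (P.eta k)⁻¹ ν (G0xi P a msq k) y z * (Qks P k * Qk P k) z z' *
            d1Kernel (P.eta k)⁻¹ ν (CxiT (P.eta k)) y' z')|
      ≤ (1 + msq) * (B₁ * W) + a * (B₂ * W) := (abs_sub _ _).trans (add_le_add hT1 hT2)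
    _ ≤ ((1 + msq) * B₁ + a * B₂ + 1) * W := by
        have key : ((1 + msq) * B₁ + a * B₂ + 1) * W = (1 + msq) * (B₁ * W) + a * (B₂ * W) + W := by ring
        linarith [hW0, key]
    _ = ((1 + msq) * B₁ + a * B₂ + 1) * ((P.eta k * (supDist y y' : ℝ)) ^ 2)⁻¹ *
          Real.exp (-(γ / 2 * (P.eta k * (supDist y y' : ℝ)))) := by rw [hW, ht, hn, mul_assoc]

/-! ## §3 "(3.16) estimated by a constant", hypothesis-free at the zero-field torus instance -/

/-- **p. 437, "we can estimate (3.16) by a constant" — FOR THE ZERO-FIELD TORUS INSTANCE WITH NO KERNEL HYPOTHESIS LEFT.**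
For odd `L > 1`, `a > 0`, `m² ≥ 0` there is ONE constant `Cst` such that for EVERY volume `P = (3, L, m, K)` of Bałaban's scalar torus
tower, every scale `1 ≤ k ≤ K` (`ξ = L^{−k}`, `j″ = k`), with `C^ξ = C^ξ_T` (`CxiT ξ`), `G^ξ_{j″} = G^ξ_{j″}(0) := G0xi P a msq k`,
`M := G^ξ_{j″}(0) − C^ξ_T` (`Mxi`), every direction `μ`, all localizations `|g|, |g′| ≤ 1`, the printed displacement `(y′_μ − y_μ)`
(`B3Taylor310Remainder.disp ξ⁻¹`) and every `y`:  `|[(3.16)](y)| ≤ Cst`.  (`B3Bound316.abs_bracket316_le_disp` with `hC` :=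
p03's `CxiT_hC`, `hG` := `G0xi_bounds_offdiag`, `hM` := `hM_zero_torus`, rates merged to their minimum, `radialConst` at `ξ = 1`.)
[cite: Balaban1983Higgs3, (3.16) p.437] -/
theorem bracket316_zero_torus (L : ℕ) (hL : Odd L ∧ 1 < L) {a : ℝ} (ha : 0 < a) {msq : ℝ} (hmsq : 0 ≤ msq) :
    ∃ Cst : ℝ, 0 < Cst ∧ ∀ (P : Params), P.d = 3 → P.L = L → ∀ k : ℕ, 1 ≤ k → k ≤ P.K →
      ∀ (g g' : SiteField P 0 ℝ) (μ : Fin P.d), (∀ y, |g y| ≤ 1) → (∀ y, |g' y| ≤ 1) → ∀ y : Site P 0,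
        |bracket316 (P.eta k) (CxiT (P.eta k)) (Mxi P a msq k) (G0xi P a msq k) g g'
            (fun μ y y' => disp (P.eta k)⁻¹ y y' μ) μ y| ≤ Cst := by
  obtain ⟨δ, C, hδ, hC, HG⟩ := G0xi_bounds_offdiag L hL ha hmsq
  obtain ⟨δ', B', hδ', hB', HM⟩ := hM_zero_torus L hL ha hmsq
  set δ₀ : ℝ := min (min δ δ') (1 / 2) with hδ₀
  have hδ₀0 : 0 < δ₀ := lt_min (lt_min hδ hδ') one_half_pos
  have hδ₀1 : δ₀ ≤ δ := (min_le_left _ _).trans (min_le_left _ _)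
  have hδ₀2 : δ₀ ≤ δ' := (min_le_left _ _).trans (min_le_right _ _)
  have hδ₀3 : δ₀ ≤ 1 / 2 := min_le_right _ _
  have hT := torusConst_nonneg
  refine ⟨3 * C * (torusConst * radialConst 3 δ₀ 1 1 + 3 * B' * radialConst 3 δ₀ 1 0) + 1, by
    have := radialConst_nonneg 3 hδ₀0 zero_le_one 1; have := radialConst_nonneg 3 hδ₀0 zero_le_one 0; positivity,
    fun P hPd hPL k hk1 hkK g g' μ hg hg' y => ?_⟩
  obtain ⟨hGv, -⟩ := HG P hPd hPL k hk1 hkK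
  have hkm : k ≤ P.m + P.K := hkK.trans (Nat.le_add_left _ _)
  have hη : 0 < P.eta k := eta_pos P k
  have hη1 : P.eta k ≤ 1 := eta_le_one P k
  have hN : 1 ≤ P.eta k * (P.sitesPerDir 0 : ℝ) := one_le_eta_mul_sitesPerDir P hkm
  -- the three kernel hypotheses with the merged rate
  have hC' : ∀ z z' : Site P 0, z' ≠ z → |CxiT (P.eta k) z z'| ≤
      torusConst * (P.eta k * supDist z z')⁻¹ * Real.exp (-(δ₀ * (P.eta k * supDist z z'))) := by
    intro z z' hne
    refine (CxiT_hC hPd hη hη1 hN z z' hne).trans ?_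
    exact mul_le_mul_of_nonneg_left (exp_rate_mono hδ₀3 (by positivity)) (by positivity)
  have hM' : ∀ (ν : Fin P.d) (z z' : Site P 0), z' ≠ z → |dKernel (P.eta k)⁻¹ ν (Mxi P a msq k) z z'| ≤
      B' * ((P.eta k * supDist z z') ^ 2)⁻¹ * Real.exp (-(δ₀ * (P.eta k * supDist z z'))) := by
    intro ν z z' hne
    refine (HM P hPd hPL k hk1 hkK ν z z' hne).trans ?_
    exact mul_le_mul_of_nonneg_left (exp_rate_mono hδ₀2 (by positivity)) (by positivity)
  have hG' : ∀ z z' : Site P 0, z' ≠ z → |G0xi P a msq k z z'| ≤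
      C * (P.eta k * supDist z z')⁻¹ * Real.exp (-(δ₀ * (P.eta k * supDist z z'))) := by
    intro z z' hne
    refine (hGv z z' hne).trans ?_
    exact mul_le_mul_of_nonneg_left (exp_rate_mono hδ₀1 (by positivity)) (by positivity)
  have h := abs_bracket316_le_disp hPd hη hδ₀0 hT hC.le hB'.le (CxiT (P.eta k)) (Mxi P a msq k) (G0xi P a msq k)
    g g' μ hC' hM' hG' hg hg' y
  refine h.trans ?_
  rw [hPd, Nat.cast_ofNat]
  have h1 := radialConst_mono 3 hδ₀0 hη1 1
  have h2 := radialConst_mono 3 hδ₀0 hη1 0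
  have h3 : 0 ≤ radialConst 3 δ₀ (P.eta k) 1 := radialConst_nonneg 3 hδ₀0 hη.le 1
  have h4 : 0 ≤ radialConst 3 δ₀ (P.eta k) 0 := radialConst_nonneg 3 hδ₀0 hη.le 0
  nlinarith [mul_le_mul_of_nonneg_left h1 hT, mul_le_mul_of_nonneg_left h2 hB'.le, hC.le]

/-- kernel: the printed displacement vanishes on the diagonal, `(y_μ − y_μ) = 0` (`|disp| ≤ c⁻¹|y − y|₁ = 0`). [cite: Balaban1983Higgs3, (3.16) p.437] -/
theorem disp_self (c : ℝ) (hc : 0 < c) (μ : Fin P.d) {j : ℕ} (y : Site P j) : disp c y y μ = 0 := by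
  have h := abs_disp_le hc y y μ
  have h0 : (Site.tdist y y : ℝ) = 0 := by simp [Site.tdist]
  rw [h0, mul_zero] at h
  exact abs_nonpos_iff.mp h

/-- **p. 437, "the coefficient in the vertex, i.e. the expression in the square brackets in (3.15)" IS BOUNDED BY A CONSTANT — for
the zero-field torus instance, hypothesis-free.**  With `G^ξ_{j″}(0) = G^ξ_{j″} := G0xi P a msq k` (the rescaled `G_k(T_ε,0)`; at zero
field the two propagators of (3.15) coincide) the (3.15) bracket on the `ξ = L^{−k}` lattice (r15's `bracket315`, printed displacement)
satisfies `|[(3.15)](y)| ≤ Cst` for every volume `P = (3, L, m, K)`, every `1 ≤ k ≤ K`, `μ`, `y`, `|g|,|g′| ≤ 1` — by the resolvent split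
`G^ξ_{j″}(0) = C^ξ_T + M` (p20's `eq316_bracket_CxiT`; `M = Mxi` by definition) and `bracket316_zero_torus`.
[cite: Balaban1983Higgs3, (3.15) p.437, (3.16) p.437] -/
theorem bracket315_zero_torus (L : ℕ) (hL : Odd L ∧ 1 < L) {a : ℝ} (ha : 0 < a) {msq : ℝ} (hmsq : 0 ≤ msq) :
    ∃ Cst : ℝ, 0 < Cst ∧ ∀ (P : Params), P.d = 3 → P.L = L → ∀ k : ℕ, 1 ≤ k → k ≤ P.K →
      ∀ (g g' : SiteField P 0 ℝ) (μ : Fin P.d), (∀ y, |g y| ≤ 1) → (∀ y, |g' y| ≤ 1) → ∀ y : Site P 0,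
        |bracket315 (P.eta k) (G0xi P a msq k) (G0xi P a msq k) g g' (fun μ y y' => disp (P.eta k)⁻¹ y y' μ) μ y| ≤ Cst := by
  obtain ⟨Cst, hCst, H⟩ := bracket316_zero_torus L hL ha hmsq
  refine ⟨Cst, hCst, fun P hPd hPL k hk1 hkK g g' μ hg hg' y => ?_⟩
  have hη : 0 < P.eta k := eta_pos P k
  have hG0 : G0xi P a msq k = fun y y' => CxiT (P.eta k) y y' + Mxi P a msq k y y' := by
    funext z z'; simp [Mxi]
  rw [eq316_bracket_CxiT hη (G0xi P a msq k) (Mxi P a msq k) (G0xi P a msq k) g g' _ μ hG0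
    (fun z => disp_self _ (inv_pos.mpr hη) μ z) y]
  exact H P hPd hPL k hk1 hkK g g' μ hg hg' y

/-- **The whole expression (3.15) has a vertex with a BOUNDED coefficient** (p. 437: (3.15) *"is represented graphically by"* a vertex
whose coefficient is *"estimate[d] … by a constant"*, whence (3.17) *"is of the required form (3.5)"*) — for the zero-field torus
instance: `|(3.15)| ≤ Cst·Σ_μΣ_y ξ³‖φ(y)‖·‖q²(∂^ξ_μφ′)(y)‖` for every volume, scale, `|g|,|g′| ≤ 1`, every scalar leg `φ` and
differentiated leg `D_μ = ∂^ξ_μφ′` (r15's `expr315`; p20's `expr315_eq_bracket316_CxiT` + `bracket316_zero_torus` + Cauchy–Schwarz).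
[cite: Balaban1983Higgs3, (3.15) p.437, (3.17) p.437] -/
theorem expr315_zero_torus (L : ℕ) (hL : Odd L ∧ 1 < L) {a : ℝ} (ha : 0 < a) {msq : ℝ} (hmsq : 0 ≤ msq) :
    ∃ Cst : ℝ, 0 < Cst ∧ ∀ (P : Params), P.d = 3 → P.L = L → ∀ k : ℕ, 1 ≤ k → k ≤ P.K →
      ∀ {W : Type*} [NormedAddCommGroup W] [InnerProductSpace ℝ W] (q : W →ₗ[ℝ] W) (g g' : SiteField P 0 ℝ)
        (φ : SiteField P 0 W) (D : Fin P.d → SiteField P 0 W), (∀ y, |g y| ≤ 1) → (∀ y, |g' y| ≤ 1) →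
        |expr315 (P.eta k) q (G0xi P a msq k) (G0xi P a msq k) g g' (fun μ y y' => disp (P.eta k)⁻¹ y y' μ) φ D| ≤
          Cst * ∑ μ : Fin P.d, ∑ y : Site P 0, P.eta k ^ P.d * (‖φ y‖ * ‖q (q (D μ y))‖) := by
  obtain ⟨Cst, hCst, H⟩ := bracket316_zero_torus L hL ha hmsq
  refine ⟨Cst, hCst, fun P hPd hPL k hk1 hkK W _ _ q g g' φ D hg hg' => ?_⟩
  have hη : 0 < P.eta k := eta_pos P k
  have hηd : 0 ≤ P.eta k ^ P.d := pow_nonneg hη.le _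
  have hG0 : G0xi P a msq k = fun y y' => CxiT (P.eta k) y y' + Mxi P a msq k y y' := by
    funext z z'; simp [Mxi]
  rw [expr315_eq_bracket316_CxiT hη q (G0xi P a msq k) (Mxi P a msq k) (G0xi P a msq k) g g' _ φ D hG0
    (fun μ z => disp_self _ (inv_pos.mpr hη) μ z), abs_neg, Finset.mul_sum]
  refine (Finset.abs_sum_le_sum_abs _ _).trans (Finset.sum_le_sum fun μ _ => ?_)
  rw [Finset.mul_sum]
  refine (Finset.abs_sum_le_sum_abs _ _).trans (Finset.sum_le_sum fun y _ => ?_)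
  rw [abs_mul, abs_of_nonneg hηd, abs_mul]
  have h1 := H P hPd hPL k hk1 hkK g g' μ hg hg' y
  have h2 : |inner ℝ (φ y) (q (q (D μ y)))| ≤ ‖φ y‖ * ‖q (q (D μ y))‖ := abs_real_inner_le_norm _ _
  calc P.eta k ^ P.d * (|bracket316 (P.eta k) (CxiT (P.eta k)) (Mxi P a msq k) (G0xi P a msq k) g g'
          (fun μ y y' => disp (P.eta k)⁻¹ y y' μ) μ y| * |inner ℝ (φ y) (q (q (D μ y)))|)
      ≤ P.eta k ^ P.d * (Cst * (‖φ y‖ * ‖q (q (D μ y))‖)) :=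
        mul_le_mul_of_nonneg_left (mul_le_mul h1 h2 (abs_nonneg _) hCst.le) hηd
    _ = Cst * (P.eta k ^ P.d * (‖φ y‖ * ‖q (q (D μ y))‖)) := by ring

end

end Literature.MathematicalPhysics.QuantumFieldTheory.Balaban1983to89.B3Bound316ZeroTorus
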